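import Summits.Ventures.PercRepro.Night2T3Profile

/-!
# PercRepro — the LINE-TYPE sets of a rank level set, part A: the line of a set and the bijection (L1)
(night-2 gen 3, NIGHT-2-profile.md §3b)

A spanning set `S ⊆ G` of a simple matroid with `m(S) = q − 2` has a cyclic part `Z(S) = S ∖ coloopsOf S` of rank `2`,
inside the line `L(S) = cl(Z(S))` (a rank-`2` flat, `lines M`); conversely every `Z ⊆ L ∩ G` with `≥ 3` points together
with a `(q − 2)`-set `K ⊆ G ∖ L` of rank `q` over `L` is such a set.  This gives the exact counts of the profile LP:

* `betaL M G L q` = `#{K ⊆ G ∖ L : |K| = q − 2, rk(K ∪ (L ∩ G)) = q}` (the bases of the contraction by the line);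
* **(L1)** `card_Pc_sub_two_eq`: `#Pc k (q−2) = Σ_{L ∈ lines M} C(|L ∩ G|, d − k + 2)·betaL M G L q`;
* **(L2)** `mv_stay_sub_two_eq`: the stay moves of the line-type sets at level `k+1` are exactly the points of their line:
  `mv k (q−2) (q−2) = Σ_L (|L ∩ G| − (d − k + 1))·C(|L ∩ G|, d − k + 1)·betaL M G L q`;
* **(L3)** `sum_card_Pc_add_lines_le_DFq`: `DF_3 ≥ Σ_{k ≤ 2} Σ_m #Pc k m + Σ_L #{A ⊆ L ∩ G : 3 ≤ |A| ≤ |L ∩ G| − 2}`;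
* `betaL_le`, `betaL_eq_zero_of_lt`: `betaL ≤ C(|G ∖ L|, q − 2)`, and `= 0` when `|G ∖ L| < q − 2`.

Part B (`Night2T3LinesB`) sums (L1), proves (L2)–(L4) and groups the lines by length.  Imports `Night2T3Profile` only.
-/
namespace PercRepro.Star

open Finset ThmH SixFour GenQ

variable {α : Type*} [DecidableEq α] {M : Matroid α} [M.Finite]

/-- The bases of the contraction by the line `L` inside `G`:
`#{K ⊆ G ∖ L : |K| = q − 2, rk(K ∪ (L ∩ G)) = q}`. -/
noncomputable def betaL (M : Matroid α) [M.Finite] (G L : Finset α) (q : ℕ) : ℕ :=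
  (((G \ L).powersetCard (q - 2)).filter
    (fun K : Finset α => M.eRk ((K ∪ (L ∩ G) : Finset α) : Set α) = (q : ℕ∞))).card

/-- `betaL ≤ C(|G ∖ L|, q − 2)`. -/
theorem betaL_le (G L : Finset α) (q : ℕ) : betaL M G L q ≤ (G \ L).card.choose (q - 2) := by
  unfold betaL
  exact (Finset.card_filter_le _ _).trans (le_of_eq (Finset.card_powersetCard _ _))

/-- `betaL = 0` when `|G ∖ L| < q − 2`. -/
theorem betaL_eq_zero_of_lt {G L : Finset α} {q : ℕ} (h : (G \ L).card < q - 2) : betaL M G L q = 0 := by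
  have := betaL_le (M := M) G L q
  rw [Nat.choose_eq_zero_of_lt h] at this
  omega

/-! ## The cyclic part of a set and its closure -/

/-- A coloop of `S` is outside the closure of the cyclic part `S ∖ coloopsOf S`. -/
theorem notMem_closure_sdiff_coloopsOf {S : Finset α} {k : α} (hk : k ∈ coloopsOf M S) :
    k ∉ M.closure ((S \ coloopsOf M S : Finset α) : Set α) := by
  intro h
  apply (mem_coloopsOf.1 hk).2
  refine M.closure_subset_closure ?_ h
  intro y hy
  have hy' := Finset.mem_coe.1 hy
  rw [Finset.mem_sdiff] at hy'
  exact Finset.mem_coe.2 (Finset.mem_erase.2 ⟨fun h' => hy'.2 (h' ▸ hk), hy'.1⟩)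

/-- The cyclic part of `S ∈ R_q(G)` has rank `q − m(S)`. -/
theorem eRk_sdiff_coloopsOf_add_mTr {G S : Finset α} {q : ℕ} (hG : G ⊆ gr M) (hS : S ∈ Rq M G q) :
    M.eRk ((S \ coloopsOf M S : Finset α) : Set α) + (mTr M S : ℕ∞) = (q : ℕ∞) := by
  have hS' := mem_Rq.1 hS
  have h := eRk_sdiff_add_card_eq_of_subset_coloopsOf (hS'.1.trans hG) (coloopsOf M S) (Finset.Subset.refl _)
  rw [hS'.2] at h
  exact h

/-- The cyclic part has `|S| − m(S)` points. -/
theorem card_sdiff_coloopsOf (S : Finset α) : (S \ coloopsOf M S).card = S.card - mTr M S := by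
  unfold mTr
  exact Finset.card_sdiff_of_subset (coloopsOf_subset S)

/-! ## The line of a line-type set -/

/-- The closure of the cyclic part of `S`, as a finset. -/
noncomputable def lineOf (M : Matroid α) [M.Finite] (S : Finset α) : Finset α :=
  clF M (S \ coloopsOf M S)

/-- For `S ∈ Pc k (q − 2)` (`q ≥ 2`): the cyclic part has rank `2`, so `lineOf S` is a line of `M`. -/
theorem lineOf_mem_lines {G S : Finset α} {q k : ℕ} (hG : G ⊆ gr M) (hq : 2 ≤ q)
    (hS : S ∈ Pc M G q k (q - 2)) : lineOf M S ∈ lines M := by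
  have hS' := mem_Pc.1 hS
  have hr := eRk_sdiff_coloopsOf_add_mTr hG hS'.1
  rw [hS'.2.2] at hr
  have hr2 : M.eRk ((S \ coloopsOf M S : Finset α) : Set α) = 2 := by
    obtain ⟨a, ha⟩ := exists_eRk_eq_nat (M := M) (S \ coloopsOf M S)
    rw [ha] at hr ⊢
    have h' : a + (q - 2) = q := by exact_mod_cast hr
    have : a = 2 := by omega
    rw [this]
    rfl
  rw [mem_lines]
  refine ⟨?_, ?_, ?_⟩
  · intro x hx
    unfold lineOf clF at hx
    rw [Set.Finite.mem_toFinset] at hx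
    rw [← Finset.mem_coe, coe_gr M]
    exact M.closure_subset_ground _ hx
  · unfold lineOf
    rw [coe_clF]
    exact Matroid.isFlat_closure _
  · unfold lineOf
    rw [coe_clF, Matroid.eRk_closure_eq, hr2]

/-- The cyclic part lies in `lineOf S ∩ G`. -/
theorem sdiff_coloopsOf_subset_lineOf_inter {G S : Finset α} {q k m : ℕ} (hG : G ⊆ gr M)
    (hS : S ∈ Pc M G q k m) : S \ coloopsOf M S ⊆ lineOf M S ∩ G := by
  have hS' := mem_Pc.1 hS
  have hSG := (mem_Rq.1 hS'.1).1
  intro z hz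
  refine Finset.mem_inter.2 ⟨?_, hSG (Finset.mem_sdiff.1 hz).1⟩
  unfold lineOf
  rw [mem_clF]
  have hzE : z ∈ M.E := by
    rw [← coe_gr M]
    exact Finset.mem_coe.2 (hG (hSG (Finset.mem_sdiff.1 hz).1))
  exact M.mem_closure_of_mem' (Finset.mem_coe.2 hz) hzE

/-- The coloops of `S` avoid `lineOf S`. -/
theorem coloopsOf_subset_sdiff_lineOf {G S : Finset α} {q k m : ℕ} (hS : S ∈ Pc M G q k m) :
    coloopsOf M S ⊆ G \ lineOf M S := by
  have hS' := mem_Pc.1 hS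
  have hSG := (mem_Rq.1 hS'.1).1
  intro c hc
  refine Finset.mem_sdiff.2 ⟨hSG (coloopsOf_subset S hc), ?_⟩
  unfold lineOf
  rw [mem_clF]
  exact notMem_closure_sdiff_coloopsOf hc

/-! ## (L1): the line-type sets on a line -/

omit [M.Finite] in
/-- A point in the closure of a set does not raise its rank. -/
theorem eRk_insert_eq_of_mem_closure' {X : Finset α} {c : α} (hc : c ∈ M.closure (X : Set α)) :
    M.eRk ((insert c X : Finset α) : Set α) = M.eRk (X : Set α) := by
  rw [Finset.coe_insert, ← Matroid.eRk_closure_eq, Matroid.closure_insert_eq_of_mem_closure hc,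
    Matroid.eRk_closure_eq]

/-- The coloops of `Z ∪ K` for `Z ⊆ L` a set of `≥ 3` points of a line `L`, `K` a `(q−2)`-set off `L` with
`rk(Z ∪ K) = q` (`q ≥ 3`): exactly `K`. -/
theorem coloopsOf_union_eq_of_line (hs : Simple M) {L Z K : Finset α} {q : ℕ} (hL : L ∈ lines M)
    (hZL : Z ⊆ L) (hZc : 3 ≤ Z.card) (hKL : Disjoint K L) (hKc : K.card = q - 2)
    (hq : 3 ≤ q) (hr : M.eRk ((Z ∪ K : Finset α) : Set α) = (q : ℕ∞)) : coloopsOf M (Z ∪ K) = K := by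
  ext c
  rw [mem_coloopsOf]
  constructor
  · rintro ⟨hc, hcl⟩
    rcases Finset.mem_union.1 hc with hcZ | hcK
    · exfalso
      apply hcl
      have hsub : Z.erase c ⊆ L := (Finset.erase_subset c Z).trans hZL
      have hc2 : 2 ≤ (Z.erase c).card := by
        rw [Finset.card_erase_of_mem hcZ]; omega
      have hcl' := closure_eq_of_subset_line hL hsub (eRk_eq_two_of_subset_line hs hL hsub hc2)
      have hmem : c ∈ M.closure ((Z.erase c : Finset α) : Set α) := by
        rw [hcl']; exact Finset.mem_coe.2 (hZL hcZ)
      refine M.closure_subset_closure ?_ hmem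
      exact Finset.coe_subset.2 (Finset.erase_subset_erase c Finset.subset_union_left)
    · exact hcK
  · intro hcK
    refine ⟨Finset.mem_union_right Z hcK, fun hcl => ?_⟩
    have hcZ : c ∉ Z := fun h => Finset.disjoint_left.1 hKL hcK (hZL h)
    have he : (Z ∪ K).erase c = Z ∪ K.erase c := by
      ext y
      simp only [Finset.mem_erase, Finset.mem_union]
      constructor
      · rintro ⟨hyc, hy | hy⟩
        · exact Or.inl hy
        · exact Or.inr ⟨hyc, hy⟩
      · rintro (hy | ⟨hyc, hy⟩)
        · exact ⟨fun h => hcZ (h ▸ hy), Or.inl hy⟩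
        · exact ⟨hyc, Or.inr hy⟩
    rw [he] at hcl
    have hZK : Z ∪ K = insert c (Z ∪ K.erase c) := by
      rw [← Finset.union_insert, Finset.insert_erase hcK]
    have h1 : M.eRk ((Z ∪ K : Finset α) : Set α) = M.eRk ((Z ∪ K.erase c : Finset α) : Set α) := by
      rw [hZK]
      exact eRk_insert_eq_of_mem_closure' hcl
    have hZ2 : M.eRk (Z : Set α) ≤ 2 := by
      rw [← (mem_lines.1 hL).2.2]
      exact M.eRk_mono (Finset.coe_subset.2 hZL)
    have hK3 : M.eRk ((K.erase c : Finset α) : Set α) ≤ ((q - 3 : ℕ) : ℕ∞) := by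
      refine (M.eRk_le_encard _).trans ?_
      rw [Set.encard_coe_eq_coe_finsetCard, Finset.card_erase_of_mem hcK, hKc]
      exact_mod_cast (by omega : q - 2 - 1 ≤ q - 3)
    have h2 : M.eRk ((Z ∪ K.erase c : Finset α) : Set α) ≤ 2 + ((q - 3 : ℕ) : ℕ∞) := by
      rw [Finset.coe_union]
      exact (M.eRk_union_le_eRk_add_eRk _ _).trans (add_le_add hZ2 hK3)
    rw [← h1, hr] at h2
    have h3 : q ≤ 2 + (q - 3) := by exact_mod_cast h2
    omega

/-- The line-type sets at level `k` whose line is `L` are in bijection with the pairs `(Z, K)`: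
`#{S ∈ Pc k (q−2) : lineOf S = L} = C(|L ∩ G|, d − k + 2)·betaL M G L q`. -/
theorem card_filter_lineOf_eq (hs : Simple M) {G : Finset α} {q d k : ℕ} (hG : G ⊆ gr M)
    (hrG : M.eRk (G : Set α) = (q : ℕ∞)) (hq : 3 ≤ q) (hcard : G.card = q + d) (hk : k < d)
    {L : Finset α} (hL : L ∈ lines M) :
    ((Pc M G q k (q - 2)).filter (fun S : Finset α => lineOf M S = L)).card =
      (L ∩ G).card.choose (d - k + 2) * betaL M G L q := by
  unfold betaL
  rw [← Finset.card_powersetCard, ← Finset.card_product]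
  refine Finset.card_bij' (fun S _ => (S \ coloopsOf M S, coloopsOf M S))
    (fun p _ => p.1 ∪ p.2) ?hi ?hj ?li ?ri
  case hi =>
    intro S hS
    rw [Finset.mem_filter] at hS
    obtain ⟨hSc, hline⟩ := hS
    have hS' := mem_Pc.1 hSc
    have hSG := (mem_Rq.1 hS'.1).1
    have hsd := Finset.card_sdiff_of_subset hSG
    have hle := Finset.card_le_card hSG
    rw [hS'.2.1] at hsd
    rw [Finset.mem_product, Finset.mem_powersetCard, Finset.mem_filter, Finset.mem_powersetCard]
    refine ⟨⟨hline ▸ sdiff_coloopsOf_subset_lineOf_inter hG hSc, ?_⟩, ⟨hline ▸ coloopsOf_subset_sdiff_lineOf hSc, hS'.2.2⟩, ?_⟩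
    · rw [card_sdiff_coloopsOf, hS'.2.2]
      omega
    · apply le_antisymm
      · rw [← hrG]
        apply M.eRk_mono
        rw [Finset.coe_union]
        refine Set.union_subset ?_ ?_
        · exact (Finset.coe_subset.2 (coloopsOf_subset S)).trans (Finset.coe_subset.2 hSG)
        · exact Finset.coe_subset.2 Finset.inter_subset_right
      · rw [← (mem_Rq.1 hS'.1).2]
        apply M.eRk_mono
        rw [Finset.coe_union]
        intro y hy
        have hy' := Finset.mem_coe.1 hy
        by_cases hyK : y ∈ coloopsOf M S
        · exact Or.inl (Finset.mem_coe.2 hyK)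
        · exact Or.inr (Finset.mem_coe.2 (hline ▸ sdiff_coloopsOf_subset_lineOf_inter hG hSc
            (Finset.mem_sdiff.2 ⟨hy', hyK⟩)))
  case hj =>
    intro p hp
    obtain ⟨Z, K⟩ := p
    simp only [Finset.mem_product, Finset.mem_powersetCard, Finset.mem_filter] at hp
    obtain ⟨⟨hZLG, hZc⟩, ⟨hKGL, hKc⟩, hrK⟩ := hp
    have hZL : Z ⊆ L := hZLG.trans Finset.inter_subset_left
    have hZG : Z ⊆ G := hZLG.trans Finset.inter_subset_right
    have hKG : K ⊆ G := hKGL.trans Finset.sdiff_subset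
    have hKL : Disjoint K L := by
      rw [Finset.disjoint_left]
      intro x hxK hxL
      exact (Finset.mem_sdiff.1 (hKGL hxK)).2 hxL
    have hZ3 : 3 ≤ Z.card := by omega
    have hZ2 : 2 ≤ Z.card := by omega
    -- `cl(Z) = L`
    have hclZ := closure_eq_of_subset_line hL hZL (eRk_eq_two_of_subset_line hs hL hZL hZ2)
    -- `rk(Z ∪ K) = q`
    have hr : M.eRk ((Z ∪ K : Finset α) : Set α) = (q : ℕ∞) := by
      apply le_antisymm
      · rw [← hrG]
        exact M.eRk_mono (Finset.coe_subset.2 (Finset.union_subset hZG hKG))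
      · rw [← hrK]
        calc M.eRk ((K ∪ (L ∩ G) : Finset α) : Set α)
            ≤ M.eRk ((K : Set α) ∪ M.closure (Z : Set α)) := by
              apply M.eRk_mono
              rw [Finset.coe_union, hclZ]
              exact Set.union_subset_union (Set.Subset.refl _) (Finset.coe_subset.2 Finset.inter_subset_left)
          _ = M.eRk ((Z ∪ K : Finset α) : Set α) := by
              rw [Matroid.eRk_union_closure_right_eq, Finset.coe_union, Set.union_comm]
    have hcol := coloopsOf_union_eq_of_line hs hL hZL hZ3 hKL hKc hq hr
    have hdisj : Disjoint Z K := by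
      rw [Finset.disjoint_left]
      intro x hxZ hxK
      exact Finset.disjoint_left.1 hKL hxK (hZL hxZ)
    have hcardZK : (Z ∪ K).card = Z.card + K.card := Finset.card_union_of_disjoint hdisj
    rw [Finset.mem_filter, mem_Pc, mem_Rq]
    refine ⟨⟨⟨Finset.union_subset hZG hKG, hr⟩, ?_, ?_⟩, ?_⟩
    · rw [Finset.card_sdiff_of_subset (Finset.union_subset hZG hKG), hcardZK, hcard, hZc, hKc]
      omega
    · unfold mTr
      rw [hcol, hKc]
    · unfold lineOf
      rw [hcol, Finset.union_sdiff_cancel_right hdisj]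
      apply Finset.coe_injective
      rw [coe_clF, hclZ]
  case li =>
    intro S _
    exact Finset.sdiff_union_of_subset (coloopsOf_subset S)
  case ri =>
    intro p hp
    obtain ⟨Z, K⟩ := p
    simp only [Finset.mem_product, Finset.mem_powersetCard, Finset.mem_filter] at hp
    obtain ⟨⟨hZLG, hZc⟩, ⟨hKGL, hKc⟩, hrK⟩ := hp
    have hZL : Z ⊆ L := hZLG.trans Finset.inter_subset_left
    have hZG : Z ⊆ G := hZLG.trans Finset.inter_subset_right
    have hKG : K ⊆ G := hKGL.trans Finset.sdiff_subset
    have hKL : Disjoint K L := by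
      rw [Finset.disjoint_left]
      intro x hxK hxL
      exact (Finset.mem_sdiff.1 (hKGL hxK)).2 hxL
    have hZ3 : 3 ≤ Z.card := by omega
    have hZ2 : 2 ≤ Z.card := by omega
    have hclZ := closure_eq_of_subset_line hL hZL (eRk_eq_two_of_subset_line hs hL hZL hZ2)
    have hr : M.eRk ((Z ∪ K : Finset α) : Set α) = (q : ℕ∞) := by
      apply le_antisymm
      · rw [← hrG]
        exact M.eRk_mono (Finset.coe_subset.2 (Finset.union_subset hZG hKG))
      · rw [← hrK]
        calc M.eRk ((K ∪ (L ∩ G) : Finset α) : Set α)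
            ≤ M.eRk ((K : Set α) ∪ M.closure (Z : Set α)) := by
              apply M.eRk_mono
              rw [Finset.coe_union, hclZ]
              exact Set.union_subset_union (Set.Subset.refl _) (Finset.coe_subset.2 Finset.inter_subset_left)
          _ = M.eRk ((Z ∪ K : Finset α) : Set α) := by
              rw [Matroid.eRk_union_closure_right_eq, Finset.coe_union, Set.union_comm]
    have hcol := coloopsOf_union_eq_of_line hs hL hZL hZ3 hKL hKc hq hr
    have hdisj : Disjoint Z K := by
      rw [Finset.disjoint_left]
      intro x hxZ hxK
      exact Finset.disjoint_left.1 hKL hxK (hZL hxZ)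
    simp only [hcol, Finset.union_sdiff_cancel_right hdisj]

end PercRepro.Star
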